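import Summits.ValiantsHypothesis.ValiantsHypothesis.Theorems.FreeSubtorusOrbitDimensionBoundStubDiagonalLiftsSemisimple
import Literature.Computability.AlgebraicComplexity.EquivariantDC
import Literature.Computability.AlgebraicComplexity.PermanentIrreducible
import Summits.ValiantsHypothesis.ValiantsHypothesis.Theorems.FreeSubtorusOrbitDimensionBoundStubPerSummand

/-!
# `OrbitDimensionBound` (stmt-ValiantsHypothesis-16133), rung line `square_covering` — stub `stub_diagonalLifts`,
# part 3: over a DIVISIBLE torus the lifts commute and diagonalise simultaneously; the stub modulo saturation

Third helper file for stub 2 `stub_diagonalLifts` of `Cruxes/OrbitDimensionBound/Lines/square_covering.lean` (route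
`FreeSubtorus`).  Parts 1–2 (`…StubDiagonalLiftsSchurian`, `…StubDiagonalLiftsSemisimple`): a stable affine pencil is
Schurian, its exact lifts are unique up to scalars, commute up to `m`-th roots of unity, and lifts of diagonal
substitutions are semisimple.  Here:

* `lift_pow` — lifts compose: `(G^k, H^k)` lifts `δ^k`;
* `lifts_commute_of_pow_eq` — if `γ' = δ^m` for a `δ` commuting with `γ` (all with lifts), then the lifts of `γ` and
  `γ'` commute EXACTLY (the commutator scalar `c` has `c^m = 1`);
* `exists_diagonalLifts_of_divisible` — for a subgroup `Γ` of DIAGONAL substitutions which is `m`-DIVISIBLE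
  (`∀ γ ∈ Γ, ∃ δ ∈ Γ, δ^m = γ`) and lifts exactly to a stable affine pencil `B`, ONE constant base change `P B Q`
  makes every lift diagonal (joint eigenbases of the commuting semisimple families `{G_γ}`, `{H_γ}`);
* **`stub_diagonalLifts_of_divisible`** — the registered stub `Stmt.stub_diagonalLifts` (vocabulary `torusGen`,
  `Admissible`, `HasDiagonalLifts` UNFOLDED) under the extra hypothesis that the torus `closure (torusGen n r Λ)` is
  `m`-divisible, with `Λ' := Λ` and `B' := ` a rescaled constant base change of `B`.

OPEN REMAINDER (stated honestly, not claimed): `closure (torusGen n r Λ)` is `m`-divisible when the lattice spanned by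
`Λ` is saturated in `ℤ^{[n] ⊔ [n]}` (the group is then a torus); in general one passes to an admissible `Λ'` of the same
rank spanning the saturation (`T_{Λ'}` = identity component of `T_Λ`, a subgroup, so equivariance descends) — this
needs the Smith normal form of `Λ` and is left to a successor; with it, `stub_diagonalLifts` follows from
`stub_diagonalLifts_of_divisible`.

Helper mode (`--supports stmt-ValiantsHypothesis-16133 --as helper`).  Honest framing: [folklore] algebra toward ONE
registered stub of a dormant rung line whose core `stub_gradedPowerCount` is OPEN; `OrbitDimensionBound`,
`FreeSubtorus` and VP ≠ VNP are OPEN and not moved.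

## References
* A. D. King, Quart. J. Math. 45 (1994), Prop. 3.1 — orientation only.
* [LandsbergRessayre2017] J. M. Landsberg, N. Ressayre, Differential Geom. Appl. 55 (2017), §3.3, §6.
-/

set_option linter.dupNamespace false

namespace Summit.ValiantsHypothesis.ValiantsHypothesis.Theorems.FreeSubtorusOrbitDimensionBound.SquareCovering

open Matrix MvPolynomial Finset Module.End
open Literature.Computability.AlgebraicComplexity LRPencil
open Summit.ValiantsHypothesis.ValiantsHypothesis.Theorems.FreeSubtorusConfusionCovering
open Summit.ValiantsHypothesis.ValiantsHypothesis.Theorems.FreeSubtorusOrbitDimensionBound.SignCovering.PerSummand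

/-! ### §1 Lifts compose; powers -/

section Compose

variable {σ : Type*} [Fintype σ] [DecidableEq σ] {m : ℕ}

/-- **Lifts compose**: if `(A, B₁)` lifts `δ` and `(A', B₁')` lifts `δ'` on `M`, then `(A A', B₁ B₁')` lifts `δ' δ`.
[folklore] -/
theorem lift_mul (M : Matrix (Fin m) (Fin m) (MvPolynomial σ ℂ)) (δ δ' : GL σ ℂ) (A B₁ A' B₁' : GL (Fin m) ℂ)
    (hA : Matrix.linSubstEntries δ M =
      (A : Matrix (Fin m) (Fin m) ℂ).map C * M * ((B₁⁻¹ : GL (Fin m) ℂ) : Matrix (Fin m) (Fin m) ℂ).map C)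
    (hA' : Matrix.linSubstEntries δ' M =
      (A' : Matrix (Fin m) (Fin m) ℂ).map C * M * ((B₁'⁻¹ : GL (Fin m) ℂ) : Matrix (Fin m) (Fin m) ℂ).map C) :
    Matrix.linSubstEntries (δ' * δ) M =
      ((A * A' : GL (Fin m) ℂ) : Matrix (Fin m) (Fin m) ℂ).map C * M *
        (((B₁ * B₁')⁻¹ : GL (Fin m) ℂ) : Matrix (Fin m) (Fin m) ℂ).map C := by
  rw [← Matrix.linSubstEntries_linSubstEntries, hA, Matrix.linSubstEntries_mul, Matrix.linSubstEntries_mul,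
    Matrix.linSubstEntries_map_C, Matrix.linSubstEntries_map_C, hA', _root_.mul_inv_rev, Units.val_mul, Units.val_mul,
    Matrix.map_mul, Matrix.map_mul]
  simp only [Matrix.mul_assoc]

/-- **Powers of a lift**: `(G^k, H^k)` lifts `δ^k`. [folklore] -/
theorem lift_pow (M : Matrix (Fin m) (Fin m) (MvPolynomial σ ℂ)) (δ : GL σ ℂ) (G H : GL (Fin m) ℂ)
    (hG : Matrix.linSubstEntries δ M =
      (G : Matrix (Fin m) (Fin m) ℂ).map C * M * ((H⁻¹ : GL (Fin m) ℂ) : Matrix (Fin m) (Fin m) ℂ).map C) (k : ℕ) :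
    Matrix.linSubstEntries (δ ^ k) M =
      ((G ^ k : GL (Fin m) ℂ) : Matrix (Fin m) (Fin m) ℂ).map C * M *
        (((H ^ k)⁻¹ : GL (Fin m) ℂ) : Matrix (Fin m) (Fin m) ℂ).map C := by
  induction k with
  | zero =>
    rw [pow_zero, pow_zero, pow_zero, inv_one, Units.val_one, Matrix.linSubstEntries_one, Matrix.map_one C C_0 C_1,
      Matrix.one_mul, Matrix.mul_one]
  | succ k ih =>
    rw [pow_succ, lift_mul M δ (δ ^ k) G H (G ^ k) (H ^ k) hG ih, ← pow_succ', ← pow_succ']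

/-- From `X Y = c • Y X` to `X Y^k = c^k • Y^k X`. [folklore] -/
theorem mul_pow_eq_smul_of_mul_eq_smul (X Y : Matrix (Fin m) (Fin m) ℂ) (c : ℂ) (h : X * Y = c • (Y * X)) (k : ℕ) :
    X * Y ^ k = c ^ k • (Y ^ k * X) := by
  induction k with
  | zero => rw [pow_zero, pow_zero, one_smul, Matrix.mul_one, Matrix.one_mul]
  | succ k ih =>
    rw [pow_succ, ← Matrix.mul_assoc, ih, Matrix.smul_mul, Matrix.mul_assoc, h, Matrix.mul_smul, smul_smul,
      ← Matrix.mul_assoc, ← pow_succ, ← pow_succ]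

/-- **Exact commutation through an `m`-th power.**  On a stable pencil (`det M ≠ 0`, not block-decomposable), if
`γ δ = δ γ`, `(G, H)` lifts `γ`, `(Gδ, Hδ)` lifts `δ` and `(G', H')` lifts `δ^m`, then `G G' = G' G` and `H H' = H' H`.
[folklore] -/
theorem lifts_commute_of_pow_eq (M : Matrix (Fin m) (Fin m) (MvPolynomial σ ℂ)) (hM : M.det ≠ 0)
    (hnb : ¬ IsBlockDecomposable M) (γ δ : GL σ ℂ) (hcomm : γ * δ = δ * γ) (G H Gδ Hδ G' H' : GL (Fin m) ℂ)
    (hG : Matrix.linSubstEntries γ M =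
      (G : Matrix (Fin m) (Fin m) ℂ).map C * M * ((H⁻¹ : GL (Fin m) ℂ) : Matrix (Fin m) (Fin m) ℂ).map C)
    (hGδ : Matrix.linSubstEntries δ M =
      (Gδ : Matrix (Fin m) (Fin m) ℂ).map C * M * ((Hδ⁻¹ : GL (Fin m) ℂ) : Matrix (Fin m) (Fin m) ℂ).map C)
    (hG' : Matrix.linSubstEntries (δ ^ m) M =
      (G' : Matrix (Fin m) (Fin m) ℂ).map C * M * ((H'⁻¹ : GL (Fin m) ℂ) : Matrix (Fin m) (Fin m) ℂ).map C) :
    (G : Matrix (Fin m) (Fin m) ℂ) * (G' : Matrix (Fin m) (Fin m) ℂ) = (G' : Matrix (Fin m) (Fin m) ℂ) * G ∧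
      (H : Matrix (Fin m) (Fin m) ℂ) * (H' : Matrix (Fin m) (Fin m) ℂ) = (H' : Matrix (Fin m) (Fin m) ℂ) * H := by
  obtain ⟨c, hcm, hcG, hcH⟩ := lift_comm_up_to_scalar M hM hnb γ δ hcomm G H Gδ Hδ hG hGδ
  rw [Units.val_mul, Units.val_mul] at hcG hcH
  -- the chosen lift of `δ^m` is a scalar multiple of `(Gδ^m, Hδ^m)`
  have hpow := lift_pow M δ Gδ Hδ hGδ m
  obtain ⟨c', hc'G, hc'H⟩ := lift_eq_smul_of_not_isBlockDecomposable M hM hnb G' H' (Gδ ^ m) (Hδ ^ m)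
    (hG'.symm.trans hpow)
  rw [Units.val_pow_eq_pow_val] at hc'G hc'H
  have h1 := mul_pow_eq_smul_of_mul_eq_smul (G : Matrix (Fin m) (Fin m) ℂ) (Gδ : Matrix (Fin m) (Fin m) ℂ) c hcG m
  have h2 := mul_pow_eq_smul_of_mul_eq_smul (H : Matrix (Fin m) (Fin m) ℂ) (Hδ : Matrix (Fin m) (Fin m) ℂ) c hcH m
  rw [hcm, one_smul] at h1 h2
  refine ⟨?_, ?_⟩
  · rw [hc'G, Matrix.mul_smul, h1, Matrix.smul_mul]
  · rw [hc'H, Matrix.mul_smul, h2, Matrix.smul_mul]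

end Compose

/-! ### §2 Simultaneous diagonal lifts over a divisible torus -/

section Divisible

variable {n m : ℕ}

/-- Diagonal entries of a diagonal matrix conjugate to an invertible one are non-zero. [folklore] -/
theorem diag_ne_zero_of_conj {P P' : Matrix (Fin m) (Fin m) ℂ} {χ : Fin m → ℂ} (G : GL (Fin m) ℂ)
    (h : (G : Matrix (Fin m) (Fin m) ℂ) = P * Matrix.diagonal χ * P') (i : Fin m) : χ i ≠ 0 := by
  have hdet := congrArg Matrix.det h
  rw [Matrix.det_mul, Matrix.det_mul, Matrix.det_diagonal] at hdet
  have hG : (G : Matrix (Fin m) (Fin m) ℂ).det ≠ 0 := by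
    simpa [Matrix.GeneralLinearGroup.val_det_apply] using (Matrix.GeneralLinearGroup.det G).ne_zero
  rw [hdet] at hG
  have := (mul_ne_zero_iff.1 (mul_ne_zero_iff.1 hG).1).2
  exact (Finset.prod_ne_zero_iff.1 this) i (Finset.mem_univ i)

/-- **Simultaneous diagonal lifts over a divisible group of diagonal substitutions.**  Let `B` be a stable affine
pencil (affine entries, `det B ≠ 0`, not block-decomposable) and `Γ` a subgroup of DIAGONAL substitutions which is
`m`-divisible and every element of which lifts exactly to `B`.  Then for suitable `P, Q ∈ GL_m(ℂ)` every `γ ∈ Γ` lifts to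
`P B Q` by a pair of invertible DIAGONAL matrices. [folklore] -/
theorem exists_diagonalLifts_of_divisible (B : Matrix (Fin m) (Fin m) (MvPolynomial (Fin n × Fin n) ℂ))
    (haff : ∀ i j, (B i j).totalDegree ≤ 1) (hM : B.det ≠ 0) (hnb : ¬ IsBlockDecomposable B)
    (Γ : Subgroup (GL (Fin n × Fin n) ℂ))
    (hdiag : ∀ γ ∈ Γ, ∃ t : Fin n × Fin n → ℂ, (γ : Matrix (Fin n × Fin n) (Fin n × Fin n) ℂ) = Matrix.diagonal t)
    (hdiv : ∀ γ ∈ Γ, ∃ δ ∈ Γ, δ ^ m = γ)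
    (hlifts : ∀ γ ∈ Γ, ∃ G H : GL (Fin m) ℂ, Matrix.linSubstEntries γ B =
      (G : Matrix (Fin m) (Fin m) ℂ).map C * B * ((H⁻¹ : GL (Fin m) ℂ) : Matrix (Fin m) (Fin m) ℂ).map C) :
    ∃ P Q : GL (Fin m) ℂ, ∀ γ ∈ Γ, ∃ u v : Fin m → ℂˣ,
      Matrix.linSubstEntries γ ((P : Matrix (Fin m) (Fin m) ℂ).map C * B * (Q : Matrix (Fin m) (Fin m) ℂ).map C) =
        (Matrix.diagonal fun i => C (u i : ℂ)) *
          ((P : Matrix (Fin m) (Fin m) ℂ).map C * B * (Q : Matrix (Fin m) (Fin m) ℂ).map C) *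
          Matrix.diagonal fun i => C (v i : ℂ) := by
  classical
  -- commuting generators: diagonal matrices commute
  have hcommΓ : ∀ γ ∈ Γ, ∀ γ' ∈ Γ, γ * γ' = γ' * γ := by
    intro γ hγ γ' hγ'
    obtain ⟨t, ht⟩ := hdiag γ hγ
    obtain ⟨t', ht'⟩ := hdiag γ' hγ'
    apply Units.ext
    rw [Units.val_mul, Units.val_mul, ht, ht', Matrix.diagonal_mul_diagonal, Matrix.diagonal_mul_diagonal]
    congr 1; ext p; exact mul_comm _ _
  -- chosen lifts
  choose G H hGH using hlifts
  set S := {γ : GL (Fin n × Fin n) ℂ // γ ∈ Γ} with hS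
  let MW : S → Matrix (Fin m) (Fin m) ℂ := fun γ => (G γ.1 γ.2 : Matrix (Fin m) (Fin m) ℂ)
  let MV : S → Matrix (Fin m) (Fin m) ℂ := fun γ => (H γ.1 γ.2 : Matrix (Fin m) (Fin m) ℂ)
  -- semisimplicity
  have hss : ∀ γ : S,
      (∀ (μ : ℂ) (x : Fin m → ℂ), x ∈ Module.End.maxGenEigenspace (Matrix.toLin' (MW γ)) μ →
        Matrix.toLin' (MW γ) x = μ • x) ∧
      (∀ (μ : ℂ) (x : Fin m → ℂ), x ∈ Module.End.maxGenEigenspace (Matrix.toLin' (MV γ)) μ →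
        Matrix.toLin' (MV γ) x = μ • x) := by
    intro γ
    obtain ⟨t, ht⟩ := hdiag γ.1 γ.2
    exact lift_semisimple_of_stable B haff hM hnb t γ.1 ht (G γ.1 γ.2) (H γ.1 γ.2) (hGH γ.1 γ.2)
  -- exact commutation (divisibility)
  have hcommW : ∀ γ γ' : S, MW γ * MW γ' = MW γ' * MW γ ∧ MV γ * MV γ' = MV γ' * MV γ := by
    intro γ γ'
    obtain ⟨δ, hδ, hδm⟩ := hdiv γ'.1 γ'.2
    have hlift' : Matrix.linSubstEntries (δ ^ m) B = (G γ'.1 γ'.2 : Matrix (Fin m) (Fin m) ℂ).map C * B *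
        (((H γ'.1 γ'.2)⁻¹ : GL (Fin m) ℂ) : Matrix (Fin m) (Fin m) ℂ).map C := by rw [hδm]; exact hGH γ'.1 γ'.2
    exact lifts_commute_of_pow_eq B hM hnb γ.1 δ (hcommΓ _ γ.2 _ hδ) (G γ.1 γ.2) (H γ.1 γ.2) (G δ hδ) (H δ hδ)
      (G γ'.1 γ'.2) (H γ'.1 γ'.2) (hGH γ.1 γ.2) (hGH δ hδ) hlift'
  -- joint eigenbases
  obtain ⟨P, P', χ, hPP', hP'P, hPdiag⟩ := exists_jointEigenBasis MW (fun γ => (hss γ).1) (fun γ γ' => (hcommW γ γ').1)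
  obtain ⟨R, R', ψ, hRR', hR'R, hRdiag⟩ := exists_jointEigenBasis MV (fun γ => (hss γ).2) (fun γ γ' => (hcommW γ γ').2)
  have hP'det : P'.det ≠ 0 := by
    have h := congrArg Matrix.det hP'P; rw [Matrix.det_mul, Matrix.det_one] at h; exact left_ne_zero_of_mul_eq_one h
  have hRdet : R.det ≠ 0 := by
    have h := congrArg Matrix.det hRR'; rw [Matrix.det_mul, Matrix.det_one] at h; exact left_ne_zero_of_mul_eq_one h
  refine ⟨Matrix.GeneralLinearGroup.mkOfDetNeZero P' hP'det, Matrix.GeneralLinearGroup.mkOfDetNeZero R hRdet,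
    fun γ hγ => ?_⟩
  rw [Matrix.GeneralLinearGroup.val_mkOfDetNeZero, Matrix.GeneralLinearGroup.val_mkOfDetNeZero]
  set g : S := ⟨γ, hγ⟩ with hg
  have hχ0 : ∀ i, χ i g ≠ 0 := diag_ne_zero_of_conj (G γ hγ) (hPdiag g)
  have hψ0 : ∀ i, ψ i g ≠ 0 := diag_ne_zero_of_conj (H γ hγ) (hRdiag g)
  refine ⟨fun i => Units.mk0 (χ i g) (hχ0 i), fun i => Units.mk0 ((ψ i g)⁻¹) (inv_ne_zero (hψ0 i)), ?_⟩
  simp only [Units.val_mk0]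
  -- the lift equation for `γ`, conjugated
  have hlift := hGH γ hγ
  have hGval : (G γ hγ : Matrix (Fin m) (Fin m) ℂ) = P * Matrix.diagonal (fun i => χ i g) * P' := hPdiag g
  have hHval : (H γ hγ : Matrix (Fin m) (Fin m) ℂ) = R * Matrix.diagonal (fun i => ψ i g) * R' := hRdiag g
  have hDψ : Matrix.diagonal (fun i => ψ i g) * Matrix.diagonal (fun i => (ψ i g)⁻¹) = 1 := by
    rw [Matrix.diagonal_mul_diagonal, ← Matrix.diagonal_one]; congr 1; ext i; exact mul_inv_cancel₀ (hψ0 i)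
  have hHinv : (((H γ hγ)⁻¹ : GL (Fin m) ℂ) : Matrix (Fin m) (Fin m) ℂ) = R * Matrix.diagonal (fun i => (ψ i g)⁻¹) * R' := by
    rw [Matrix.coe_units_inv, hHval]
    refine Matrix.inv_eq_right_inv ?_
    calc R * Matrix.diagonal (fun i => ψ i g) * R' * (R * Matrix.diagonal (fun i => (ψ i g)⁻¹) * R')
        = R * (Matrix.diagonal (fun i => ψ i g) * ((R' * R) * Matrix.diagonal (fun i => (ψ i g)⁻¹))) * R' := by
          simp only [Matrix.mul_assoc]
      _ = 1 := by rw [hR'R, Matrix.one_mul, hDψ, Matrix.mul_one, hRR']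
  have hC0 : ((C : ℂ →+* MvPolynomial (Fin n × Fin n) ℂ) : ℂ → MvPolynomial (Fin n × Fin n) ℂ) 0 = 0 := C_0
  rw [Matrix.linSubstEntries_mul, Matrix.linSubstEntries_mul, Matrix.linSubstEntries_map_C, Matrix.linSubstEntries_map_C,
    hlift, hGval, hHinv]
  simp only [Matrix.map_mul, Matrix.diagonal_map hC0, Matrix.mul_assoc]
  rw [← Matrix.mul_assoc ((P' : Matrix (Fin m) (Fin m) ℂ).map C), ← Matrix.map_mul (L := P') (M := P), hP'P,
    Matrix.map_one C C_0 C_1, Matrix.one_mul, ← Matrix.map_mul (L := R') (M := R), hR'R, Matrix.map_one C C_0 C_1,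
    Matrix.mul_one]

end Divisible

/-! ### §3 The registered stub modulo divisibility of the torus -/

section Stub

/-- Elements of the group generated by diagonal torus substitutions are diagonal. [folklore] -/
theorem exists_eq_diagonal_of_mem_closure {n : ℕ} (T : Set (GL (Fin n × Fin n) ℂ))
    (hT : ∀ γ ∈ T, ∃ t : Fin n × Fin n → ℂ, (γ : Matrix (Fin n × Fin n) (Fin n × Fin n) ℂ) = Matrix.diagonal t)
    (γ : GL (Fin n × Fin n) ℂ) (hγ : γ ∈ Subgroup.closure T) :
    ∃ t : Fin n × Fin n → ℂ, (γ : Matrix (Fin n × Fin n) (Fin n × Fin n) ℂ) = Matrix.diagonal t := by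
  refine Subgroup.closure_induction (p := fun (γ : GL (Fin n × Fin n) ℂ) (_ : γ ∈ Subgroup.closure T) =>
      ∃ t : Fin n × Fin n → ℂ, (γ : Matrix (Fin n × Fin n) (Fin n × Fin n) ℂ) = Matrix.diagonal t) ?_ ?_ ?_ ?_ hγ
  · intro γ hγT; exact hT γ hγT
  · exact ⟨fun _ => 1, by rw [Units.val_one, Matrix.diagonal_one]⟩
  · rintro γ δ _ _ ⟨t, ht⟩ ⟨t', ht'⟩
    exact ⟨fun p => t p * t' p, by rw [Units.val_mul, ht, ht', Matrix.diagonal_mul_diagonal]⟩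
  · rintro γ _ ⟨t, ht⟩
    have ht0 : ∀ p, t p ≠ 0 := by
      intro p
      have hdet : (γ : Matrix (Fin n × Fin n) (Fin n × Fin n) ℂ).det ≠ 0 := by
        simpa [Matrix.GeneralLinearGroup.val_det_apply] using (Matrix.GeneralLinearGroup.det γ).ne_zero
      rw [ht, Matrix.det_diagonal] at hdet
      exact (Finset.prod_ne_zero_iff.1 hdet) p (Finset.mem_univ p)
    refine ⟨fun p => (t p)⁻¹, ?_⟩
    rw [Matrix.coe_units_inv, ht]
    refine Matrix.inv_eq_right_inv ?_
    rw [Matrix.diagonal_mul_diagonal, ← Matrix.diagonal_one]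
    congr 1; ext p; exact mul_inv_cancel₀ (ht0 p)

/-- **Stub 2 of the line `square_covering` modulo divisibility of the torus** (`Stmt.stub_diagonalLifts` with
`torusGen`, `Admissible`, `HasDiagonalLifts` unfolded, plus ONE extra hypothesis): if the group `T_Λ` generated by the
torus substitutions satisfying the relations `Λ` is `m`-divisible (every element is an `m`-th power inside the group —
true e.g. when the lattice spanned by `Λ` is saturated), then a block-indecomposable `T_Λ`-equivariant affine
representation `B` of `per_n ^ j` can be replaced by one (same size, same `Λ`) all of whose lifts are DIAGONAL.
(Stable ⇒ Schurian ⇒ lifts unique up to scalars ⇒ semisimple and, by divisibility, commuting ⇒ one joint eigenbasis;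
then rescale for `det = per_n ^ j` exactly.)  The saturation step that removes the extra hypothesis (pass to `Λ'` =
a basis of the saturation) is the open remainder. [cite: LandsbergRessayre2017, §3, §6] -/
theorem stub_diagonalLifts_of_divisible :
    ∀ (n j m r : ℕ) (Λ : Fin r → (Fin n ⊕ Fin n) → ℤ) (B : Matrix (Fin m) (Fin m) (MvPolynomial (Fin n × Fin n) ℂ)),
      3 ≤ n → 1 ≤ j → (∀ i, (∑ k, Λ i (Sum.inl k)) = 0 ∧ (∑ l, Λ i (Sum.inr l)) = 0) →
      IsEquivariantDetRepr (Subgroup.closure {γ : Matrix.GeneralLinearGroup (Fin n × Fin n) ℂ |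
          ∃ d e : Fin n → ℂˣ, (∀ i, (∏ k, (d k) ^ (Λ i (Sum.inl k))) * (∏ l, (e l) ^ (Λ i (Sum.inr l))) = 1) ∧
            (γ : Matrix (Fin n × Fin n) (Fin n × Fin n) ℂ) = Matrix.diagonal (fun p => (d p.1 : ℂ) * (e p.2 : ℂ))})
        (perPoly (Fin n) ℂ ^ j) B →
      ¬ IsBlockDecomposable B →
      (∀ γ ∈ Subgroup.closure {γ : Matrix.GeneralLinearGroup (Fin n × Fin n) ℂ |
          ∃ d e : Fin n → ℂˣ, (∀ i, (∏ k, (d k) ^ (Λ i (Sum.inl k))) * (∏ l, (e l) ^ (Λ i (Sum.inr l))) = 1) ∧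
            (γ : Matrix (Fin n × Fin n) (Fin n × Fin n) ℂ) = Matrix.diagonal (fun p => (d p.1 : ℂ) * (e p.2 : ℂ))},
        ∃ δ ∈ Subgroup.closure {γ : Matrix.GeneralLinearGroup (Fin n × Fin n) ℂ |
          ∃ d e : Fin n → ℂˣ, (∀ i, (∏ k, (d k) ^ (Λ i (Sum.inl k))) * (∏ l, (e l) ^ (Λ i (Sum.inr l))) = 1) ∧
            (γ : Matrix (Fin n × Fin n) (Fin n × Fin n) ℂ) = Matrix.diagonal (fun p => (d p.1 : ℂ) * (e p.2 : ℂ))}, δ ^ m = γ) →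
      ∃ (Λ' : Fin r → (Fin n ⊕ Fin n) → ℤ) (B' : Matrix (Fin m) (Fin m) (MvPolynomial (Fin n × Fin n) ℂ)),
        (∀ i, (∑ k, Λ' i (Sum.inl k)) = 0 ∧ (∑ l, Λ' i (Sum.inr l)) = 0) ∧
        IsAffineDetRepr (perPoly (Fin n) ℂ ^ j) B' ∧
        ∀ γ ∈ Subgroup.closure {γ : Matrix.GeneralLinearGroup (Fin n × Fin n) ℂ |
          ∃ d e : Fin n → ℂˣ, (∀ i, (∏ k, (d k) ^ (Λ' i (Sum.inl k))) * (∏ l, (e l) ^ (Λ' i (Sum.inr l))) = 1) ∧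
            (γ : Matrix (Fin n × Fin n) (Fin n × Fin n) ℂ) = Matrix.diagonal (fun p => (d p.1 : ℂ) * (e p.2 : ℂ))},
          ∃ u v : Fin m → ℂˣ,
            Matrix.linSubstEntries γ B' =
              (Matrix.diagonal fun i => C (u i : ℂ)) * B' * Matrix.diagonal fun i => C (v i : ℂ) := by
  intro n j m r Λ B hn hj hΛ hB hnb hdiv
  classical
  haveI : Nonempty (Fin n) := ⟨⟨0, by omega⟩⟩
  have hper : Irreducible (perPoly (Fin n) ℂ) := perPoly_irreducible
  have hdetB : B.det ≠ 0 := by rw [hB.1.2]; exact pow_ne_zero _ hper.ne_zero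
  have hdiagΓ := exists_eq_diagonal_of_mem_closure
    {γ : Matrix.GeneralLinearGroup (Fin n × Fin n) ℂ |
          ∃ d e : Fin n → ℂˣ, (∀ i, (∏ k, (d k) ^ (Λ i (Sum.inl k))) * (∏ l, (e l) ^ (Λ i (Sum.inr l))) = 1) ∧
            (γ : Matrix (Fin n × Fin n) (Fin n × Fin n) ℂ) = Matrix.diagonal (fun p => (d p.1 : ℂ) * (e p.2 : ℂ))}
    (by rintro γ ⟨d, e, -, hγ⟩; exact ⟨_, hγ⟩)
  obtain ⟨P, Q, hPQ⟩ := exists_diagonalLifts_of_divisible B hB.1.1 hdetB hnb _ hdiagΓ hdiv hB.2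
  -- `m ≥ 1`
  have hm : 0 < m := by
    rcases Nat.eq_zero_or_pos m with h0 | h0
    · exfalso
      subst h0
      have h1 : B.det = 1 := Matrix.det_isEmpty
      have h2 := hB.1.2
      rw [h1] at h2
      have h3 : IsUnit (perPoly (Fin n) ℂ ^ j) := h2 ▸ isUnit_one
      exact hper.not_isUnit ((isUnit_pow_iff (by omega)).1 h3)
    · exact h0
  -- rescale
  set Pm : Matrix (Fin m) (Fin m) ℂ := (P : Matrix (Fin m) (Fin m) ℂ) with hPm
  set Qm : Matrix (Fin m) (Fin m) ℂ := (Q : Matrix (Fin m) (Fin m) ℂ) with hQm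
  have hPdet : Pm.det ≠ 0 := by
    simpa [hPm, Matrix.GeneralLinearGroup.val_det_apply] using (Matrix.GeneralLinearGroup.det P).ne_zero
  have hQdet : Qm.det ≠ 0 := by
    simpa [hQm, Matrix.GeneralLinearGroup.val_det_apply] using (Matrix.GeneralLinearGroup.det Q).ne_zero
  obtain ⟨ξ, hξ⟩ := IsAlgClosed.exists_pow_nat_eq ((Pm.det * Qm.det)⁻¹) hm
  set B'' : Matrix (Fin m) (Fin m) (MvPolynomial (Fin n × Fin n) ℂ) := Pm.map C * B * Qm.map C with hB''
  set Z : Matrix (Fin m) (Fin m) ℂ := ξ • (1 : Matrix (Fin m) (Fin m) ℂ) with hZ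
  have hZC : (Z.map C : Matrix (Fin m) (Fin m) (MvPolynomial (Fin n × Fin n) ℂ)) = Matrix.diagonal fun _ => C ξ := by
    ext i j
    by_cases hij : i = j
    · subst hij; simp [hZ]
    · simp [hZ, hij]
  refine ⟨Λ, Z.map C * B'', hΛ, ⟨?_, ?_⟩, ?_⟩
  · intro i j'
    rw [hZ, smul_one_map_C_mul_apply]
    exact (totalDegree_mul _ _).trans (by
      rw [totalDegree_C, zero_add, hB'']; exact totalDegree_map_C_mul_mul_map_C_le Pm Qm hB.1.1 _ _)
  · rw [Matrix.det_mul, det_map_C, hZ, Matrix.det_smul, Matrix.det_one, mul_one, Fintype.card_fin, hξ, hB'',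
      det_map_C_mul_mul_map_C, hB.1.2, ← mul_assoc, ← map_mul, inv_mul_cancel₀ (mul_ne_zero hPdet hQdet), C_1,
      one_mul]
  · intro γ hγ
    obtain ⟨u, v, huv⟩ := hPQ γ hγ
    refine ⟨u, v, ?_⟩
    rw [Matrix.linSubstEntries_mul, Matrix.linSubstEntries_map_C, huv, hZC]
    have hcomm : ((Matrix.diagonal fun _ => C ξ : Matrix (Fin m) (Fin m) (MvPolynomial (Fin n × Fin n) ℂ)) *
        Matrix.diagonal fun i => C (u i : ℂ)) =
        (Matrix.diagonal fun i => C (u i : ℂ)) * Matrix.diagonal fun _ => C ξ := by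
      rw [Matrix.diagonal_mul_diagonal, Matrix.diagonal_mul_diagonal]
      exact congrArg Matrix.diagonal (funext fun i => mul_comm _ _)
    simp only [← Matrix.mul_assoc]
    rw [hcomm]

end Stub

end Summit.ValiantsHypothesis.ValiantsHypothesis.Theorems.FreeSubtorusOrbitDimensionBound.SquareCovering
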